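import Mathlib
import Summits.Ventures.PercRepro2.EightTypedIndex

/-!
# Eight typed edges, V′: the placement list IS the index enumeration — structurally, for every type vector
(blind cell PercRepro2, night-3 g10, 2026-08-26)

**`pl8_eq_range`**: `pl8 k₁ … k₈ = (List.range 6561).map (placeOf8 k₁ … k₈)` for all `k_j ∈ {1, 2}`, proved once by the
base-`3` decomposition of `List.range` (`range_mul_eq_flatMap`), the digit lemma `dg8_split` and the eight enumeration
levels `enumL_8 … enumL_1` — in place of one kernel `decide` of ≈ 28 s per type vector (256 of them).
-/

namespace Summit.Ventures.PercRepro2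

open UnionCluster

namespace CovForm

namespace TwoTyped

open OneTyped

section PlaceEnum8

/-- `List.range (a * b)` enumerates `d * b + r` for `d < a`, `r < b`, `d` slowest. -/
theorem range_mul_eq_flatMap (a b : ℕ) :
    List.range (a * b) = (List.range a).flatMap fun d => (List.range b).map fun r => d * b + r := by
  induction a with
  | zero => simp
  | succ a ih =>
    rw [Nat.succ_mul, List.range_add, ih, List.range_succ, List.flatMap_append, List.flatMap_singleton]

/-- `Tk7 k` is the image of the three digits under the bit map `tb7 k`, for `k ∈ {1, 2}`. -/
theorem Tk7_eq_map (k : ℕ) (hk : k = 1 ∨ k = 2) :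
    Tk7 k = (List.range 3).map fun d => (tb7 k d 0, tb7 k d 1, tb7 k d 2) := by
  rcases hk with rfl | rfl <;> decide

/-- The digits of `d * 3^j + r` (`d < 3`, `r < 3^j`, `j < 8`; `p = 3^j` given as a literal): digit `j` is `d`, the lower
digits are those of `r`. -/
theorem dg8_split (j : ℕ) (hj : j < 8) (p : ℕ) (hp : 3 ^ j = p) (d r : ℕ) (hd : d < 3) (hr : r < p) :
    dg8 (d * p + r) j = d ∧ ∀ i, i < j → dg8 (d * p + r) i = dg8 r i := by
  subst hp
  interval_cases j <;> simp only [pow_zero, pow_one, Nat.reducePow] at hr ⊢ <;>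
    refine ⟨by simp only [dg8]; omega, ?_⟩ <;> intro i hi <;> interval_cases i <;>
    simp only [dg8] <;> omega

/-- `flatMap` congruence on the list's elements. -/
theorem flatMap_congr_left {α β : Type} {l : List α} {f g : α → List β} (h : ∀ a ∈ l, f a = g a) :
    l.flatMap f = l.flatMap g := by
  unfold List.flatMap
  exact congrArg List.flatten (List.map_congr_left h)

/-- Enumeration level `8`: digits `8` … `8` nested over `range 3` = one `range 3` read by `dg8`. -/
theorem enumL_8 {α : Type} (G : ℕ → α) :
    ((List.range 3).map fun d8 => G d8) = (List.range 3).map fun n => G (dg8 n 0) := by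
  apply List.map_congr_left
  intro n hn
  rw [List.mem_range] at hn
  simp only [dg8]
  rw [Nat.mod_eq_of_lt hn]

/-- Enumeration level `7`: digits `7` … `8` nested over `range 3` = one `range 9` read by `dg8`. -/
theorem enumL_7 {α : Type} (G : ℕ → ℕ → α) :
    ((List.range 3).flatMap fun d7 => (List.range 3).map fun d8 => G d7 d8) = (List.range 9).map fun n => G (dg8 n 1) (dg8 n 0) := by
  rw [show (9 : ℕ) = 3 * 3 from rfl, range_mul_eq_flatMap, List.map_flatMap]
  apply flatMap_congr_left
  intro d7 hd7
  rw [List.mem_range] at hd7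
  rw [List.map_map, enumL_8 (G d7)]
  apply List.map_congr_left
  intro r hr
  rw [List.mem_range] at hr
  simp only [Function.comp]
  have hs := dg8_split 1 (by norm_num) 3 (by norm_num) d7 r hd7 hr
  simp only [hs.1, hs.2 0 (by norm_num)]

/-- Enumeration level `6`: digits `6` … `8` nested over `range 3` = one `range 27` read by `dg8`. -/
theorem enumL_6 {α : Type} (G : ℕ → ℕ → ℕ → α) :
    ((List.range 3).flatMap fun d6 => (List.range 3).flatMap fun d7 => (List.range 3).map fun d8 => G d6 d7 d8) = (List.range 27).map fun n => G (dg8 n 2) (dg8 n 1) (dg8 n 0) := by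
  rw [show (27 : ℕ) = 3 * 9 from rfl, range_mul_eq_flatMap, List.map_flatMap]
  apply flatMap_congr_left
  intro d6 hd6
  rw [List.mem_range] at hd6
  rw [List.map_map, enumL_7 (G d6)]
  apply List.map_congr_left
  intro r hr
  rw [List.mem_range] at hr
  simp only [Function.comp]
  have hs := dg8_split 2 (by norm_num) 9 (by norm_num) d6 r hd6 hr
  simp only [hs.1, hs.2 1 (by norm_num), hs.2 0 (by norm_num)]

/-- Enumeration level `5`: digits `5` … `8` nested over `range 3` = one `range 81` read by `dg8`. -/
theorem enumL_5 {α : Type} (G : ℕ → ℕ → ℕ → ℕ → α) :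
    ((List.range 3).flatMap fun d5 => (List.range 3).flatMap fun d6 => (List.range 3).flatMap fun d7 => (List.range 3).map fun d8 => G d5 d6 d7 d8) = (List.range 81).map fun n => G (dg8 n 3) (dg8 n 2) (dg8 n 1) (dg8 n 0) := by
  rw [show (81 : ℕ) = 3 * 27 from rfl, range_mul_eq_flatMap, List.map_flatMap]
  apply flatMap_congr_left
  intro d5 hd5
  rw [List.mem_range] at hd5
  rw [List.map_map, enumL_6 (G d5)]
  apply List.map_congr_left
  intro r hr
  rw [List.mem_range] at hr
  simp only [Function.comp]
  have hs := dg8_split 3 (by norm_num) 27 (by norm_num) d5 r hd5 hr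
  simp only [hs.1, hs.2 2 (by norm_num), hs.2 1 (by norm_num), hs.2 0 (by norm_num)]

/-- Enumeration level `4`: digits `4` … `8` nested over `range 3` = one `range 243` read by `dg8`. -/
theorem enumL_4 {α : Type} (G : ℕ → ℕ → ℕ → ℕ → ℕ → α) :
    ((List.range 3).flatMap fun d4 => (List.range 3).flatMap fun d5 => (List.range 3).flatMap fun d6 => (List.range 3).flatMap fun d7 => (List.range 3).map fun d8 => G d4 d5 d6 d7 d8) = (List.range 243).map fun n => G (dg8 n 4) (dg8 n 3) (dg8 n 2) (dg8 n 1) (dg8 n 0) := by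
  rw [show (243 : ℕ) = 3 * 81 from rfl, range_mul_eq_flatMap, List.map_flatMap]
  apply flatMap_congr_left
  intro d4 hd4
  rw [List.mem_range] at hd4
  rw [List.map_map, enumL_5 (G d4)]
  apply List.map_congr_left
  intro r hr
  rw [List.mem_range] at hr
  simp only [Function.comp]
  have hs := dg8_split 4 (by norm_num) 81 (by norm_num) d4 r hd4 hr
  simp only [hs.1, hs.2 3 (by norm_num), hs.2 2 (by norm_num), hs.2 1 (by norm_num), hs.2 0 (by norm_num)]

/-- Enumeration level `3`: digits `3` … `8` nested over `range 3` = one `range 729` read by `dg8`. -/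
theorem enumL_3 {α : Type} (G : ℕ → ℕ → ℕ → ℕ → ℕ → ℕ → α) :
    ((List.range 3).flatMap fun d3 => (List.range 3).flatMap fun d4 => (List.range 3).flatMap fun d5 => (List.range 3).flatMap fun d6 => (List.range 3).flatMap fun d7 => (List.range 3).map fun d8 => G d3 d4 d5 d6 d7 d8) = (List.range 729).map fun n => G (dg8 n 5) (dg8 n 4) (dg8 n 3) (dg8 n 2) (dg8 n 1) (dg8 n 0) := by
  rw [show (729 : ℕ) = 3 * 243 from rfl, range_mul_eq_flatMap, List.map_flatMap]
  apply flatMap_congr_left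
  intro d3 hd3
  rw [List.mem_range] at hd3
  rw [List.map_map, enumL_4 (G d3)]
  apply List.map_congr_left
  intro r hr
  rw [List.mem_range] at hr
  simp only [Function.comp]
  have hs := dg8_split 5 (by norm_num) 243 (by norm_num) d3 r hd3 hr
  simp only [hs.1, hs.2 4 (by norm_num), hs.2 3 (by norm_num), hs.2 2 (by norm_num), hs.2 1 (by norm_num), hs.2 0 (by norm_num)]

/-- Enumeration level `2`: digits `2` … `8` nested over `range 3` = one `range 2187` read by `dg8`. -/
theorem enumL_2 {α : Type} (G : ℕ → ℕ → ℕ → ℕ → ℕ → ℕ → ℕ → α) :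
    ((List.range 3).flatMap fun d2 => (List.range 3).flatMap fun d3 => (List.range 3).flatMap fun d4 => (List.range 3).flatMap fun d5 => (List.range 3).flatMap fun d6 => (List.range 3).flatMap fun d7 => (List.range 3).map fun d8 => G d2 d3 d4 d5 d6 d7 d8) = (List.range 2187).map fun n => G (dg8 n 6) (dg8 n 5) (dg8 n 4) (dg8 n 3) (dg8 n 2) (dg8 n 1) (dg8 n 0) := by
  rw [show (2187 : ℕ) = 3 * 729 from rfl, range_mul_eq_flatMap, List.map_flatMap]
  apply flatMap_congr_left
  intro d2 hd2
  rw [List.mem_range] at hd2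
  rw [List.map_map, enumL_3 (G d2)]
  apply List.map_congr_left
  intro r hr
  rw [List.mem_range] at hr
  simp only [Function.comp]
  have hs := dg8_split 6 (by norm_num) 729 (by norm_num) d2 r hd2 hr
  simp only [hs.1, hs.2 5 (by norm_num), hs.2 4 (by norm_num), hs.2 3 (by norm_num), hs.2 2 (by norm_num), hs.2 1 (by norm_num), hs.2 0 (by norm_num)]

/-- Enumeration level `1`: digits `1` … `8` nested over `range 3` = one `range 6561` read by `dg8`. -/
theorem enumL_1 {α : Type} (G : ℕ → ℕ → ℕ → ℕ → ℕ → ℕ → ℕ → ℕ → α) :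
    ((List.range 3).flatMap fun d1 => (List.range 3).flatMap fun d2 => (List.range 3).flatMap fun d3 => (List.range 3).flatMap fun d4 => (List.range 3).flatMap fun d5 => (List.range 3).flatMap fun d6 => (List.range 3).flatMap fun d7 => (List.range 3).map fun d8 => G d1 d2 d3 d4 d5 d6 d7 d8) = (List.range 6561).map fun n => G (dg8 n 7) (dg8 n 6) (dg8 n 5) (dg8 n 4) (dg8 n 3) (dg8 n 2) (dg8 n 1) (dg8 n 0) := by
  rw [show (6561 : ℕ) = 3 * 2187 from rfl, range_mul_eq_flatMap, List.map_flatMap]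
  apply flatMap_congr_left
  intro d1 hd1
  rw [List.mem_range] at hd1
  rw [List.map_map, enumL_2 (G d1)]
  apply List.map_congr_left
  intro r hr
  rw [List.mem_range] at hr
  simp only [Function.comp]
  have hs := dg8_split 7 (by norm_num) 2187 (by norm_num) d1 r hd1 hr
  simp only [hs.1, hs.2 6 (by norm_num), hs.2 5 (by norm_num), hs.2 4 (by norm_num), hs.2 3 (by norm_num), hs.2 2 (by norm_num), hs.2 1 (by norm_num), hs.2 0 (by norm_num)]

/-- **The placement list of a type vector is its index enumeration** — for every `k_j ∈ {1, 2}`, structurally. -/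
theorem pl8_eq_range (k1 k2 k3 k4 k5 k6 k7 k8 : ℕ) (h1 : k1 = 1 ∨ k1 = 2) (h2 : k2 = 1 ∨ k2 = 2) (h3 : k3 = 1 ∨ k3 = 2) (h4 : k4 = 1 ∨ k4 = 2) (h5 : k5 = 1 ∨ k5 = 2) (h6 : k6 = 1 ∨ k6 = 2) (h7 : k7 = 1 ∨ k7 = 2) (h8 : k8 = 1 ∨ k8 = 2) :
    pl8 k1 k2 k3 k4 k5 k6 k7 k8 = (List.range 6561).map (placeOf8 k1 k2 k3 k4 k5 k6 k7 k8) := by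
  unfold pl8
  rw [Tk7_eq_map k1 h1, Tk7_eq_map k2 h2, Tk7_eq_map k3 h3, Tk7_eq_map k4 h4, Tk7_eq_map k5 h5, Tk7_eq_map k6 h6, Tk7_eq_map k7 h7, Tk7_eq_map k8 h8]
  simp only [List.flatMap_map, List.map_map, Function.comp_def]
  unfold placeOf8
  exact enumL_1 (fun d1 d2 d3 d4 d5 d6 d7 d8 => (mk8 (tb7 k1 d1 0) (tb7 k2 d2 0) (tb7 k3 d3 0) (tb7 k4 d4 0) (tb7 k5 d5 0) (tb7 k6 d6 0) (tb7 k7 d7 0) (tb7 k8 d8 0), mk8 (tb7 k1 d1 1) (tb7 k2 d2 1) (tb7 k3 d3 1) (tb7 k4 d4 1) (tb7 k5 d5 1) (tb7 k6 d6 1) (tb7 k7 d7 1) (tb7 k8 d8 1), mk8 (tb7 k1 d1 2) (tb7 k2 d2 2) (tb7 k3 d3 2) (tb7 k4 d4 2) (tb7 k5 d5 2) (tb7 k6 d6 2) (tb7 k7 d7 2) (tb7 k8 d8 2)))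

end PlaceEnum8

end TwoTyped

end CovForm

end Summit.Ventures.PercRepro2
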